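import Literature.NumberTheory.Transcendental.PhilipponZeroEstimate
import Mathlib.RingTheory.MvPolynomial.Basic
import Mathlib.Algebra.MvPolynomial.Funext
import Mathlib.RingTheory.Nullstellensatz
import Mathlib.Analysis.Complex.Polynomial.Basic
import Mathlib.RingTheory.Ideal.MinimalPrime.Noetherian
import Mathlib.RingTheory.Ideal.MinimalPrime.Localization
import Mathlib.RingTheory.Ideal.Quotient.Operations
import Mathlib.RingTheory.Ideal.KrullsHeightTheorem
import Mathlib.RingTheory.KrullDimension.Polynomial
import Literature.RingTheory.KrullDimension.AffineCatenary
import HarnessLib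

/-!
# Zariski toolkit on `G = 𝔾ₐ × 𝔾ₘⁿ` with box degrees (towards Philippon's zero estimate at `T = 0`)

Topic `Literature/NumberTheory/Transcendental`. Elementary algebraic geometry of the complex points
`G(ℂ) = ℂ × (ℂˣ)ⁿ` (`GaGm n`, `PhilipponZeroEstimate.lean`) seen inside affine space `ℂⁿ⁺¹`
through `GaGm.coord`, phrased with ideals of `B = ℂ[X, Y₁, …, Y_n]`, as needed for the
multiplicity-free case of Philippon's zero estimate `Philippon1986_GaGm_P1n`
(`PhilipponZeroEstimateP1n.lean`; Nesterenko–Philippon (eds.), LNM 1752, Ch. 11, §2 and §4) and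
Diaz's zero lemma. Everything here is PROVED; no named facts.

* Box polynomials `GaGm.Box D₀ D₁ t = {P ; deg_X P ≤ tD₀, deg_{Y_h} P ≤ tD₁}` (a subspace with the
  box monomials as basis): `finrank_Box` (`dim = (tD₀+1)(tD₁+1)ⁿ`), `Box_one_pow`
  (`Box(1)^t = Box(t)`: the filtration is generated in degree one — equivalently the homogeneous
  coordinate ring of the Segre–Veronese embedding of `(ℙ¹)ⁿ⁺¹` by `𝒪(D₀, D₁, …, D₁)` is standard
  graded, which is what lets the single-graded degree theory of
  `Literature.RingTheory.HilbertSamuel.FilteredHilbert.hilbert_sandwich` replace multigraded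
  Hilbert–Samuel theory), `adjoin_Box_one`, `shift_mem_Box` (translation invariance).
* Zero sets `GaGm.zeroSet F ⊆ G(ℂ)` and vanishing ideals `GaGm.vanishing X ≤ B`, closed sets
  (`GaGm.IsClosedG`), finite unions / arbitrary intersections, and the **Nullstellensatz in
  `G(ℂ)`** (`mem_vanishing_zeroSet_iff`: `P ∈ 𝔍(Z(I)) ↔ ∃ k, (P·u)^k ∈ I`, `u = Y₁⋯Y_n`, from
  Mathlib's `MvPolynomial.vanishingIdeal_zeroLocus_eq_radical` on `ℂⁿ⁺¹`).
* Irreducible closed sets (`GaGm.IsIrred`: closed with prime vanishing ideal), the prime-avoidance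
  property for (finite) unions, and **components = minimal primes of `𝔍(X)`**
  (`isIrred_zeroSet_of_mem_minimalPrimes`, `IsClosedG.eq_biUnion_minimalPrimes`,
  `IsIrred.exists_minimalPrimes_subset`, `eq_of_zeroSet_subset_of_mem_minimalPrimes`); `G` is
  irreducible (`vanishing_univ`: a polynomial vanishing on `ℂ × (ℂˣ)ⁿ` is zero).
* Dimension `GaGm.dimG X = dim B ⧸ 𝔍(X)` (Krull): `dimG_univ = n + 1`, monotonicity, **strict
  decrease on proper closed subsets of an irreducible set** (`dimG_lt_of_ssubset`), **Krull's
  principal ideal theorem for sections** (`dimG_add_one_of_mem_minimalPrimes_section`: every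
  component of `C ∩ Z(ℓ)`, `ℓ ∉ 𝔍(C)`, has dimension `dim C - 1`; Mathlib's
  `Ideal.height_le_one_of_isPrincipal_of_mem_minimalPrimes` plus the dimension formula for affine
  domains `Literature.RingTheory.KrullDimension.ringKrullDim_quotient_add_one_of_height_eq_one`),
  the dimension of a closed set is attained on a component (`exists_minimalPrimes_dimG_eq`), and
  an irreducible closed subset of `X` of dimension `dim X` is a component
  (`IsIrred.exists_eq_zeroSet_minimalPrimes`).
* Translations: `GaGm.shift a : B →ₐ[ℂ] B` with `evalAt (shift a P) g = evalAt P (a·g)`, an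
  automorphism (`shiftEquiv`), `vanishing (a • X) = 𝔍(X).comap (shift a)`, invariance of
  closedness, irreducibility and dimension (`dimG_smul`).

## References

* Yu. V. Nesterenko, P. Philippon (eds.), *Introduction to Algebraic Independence Theory*,
  LNM 1752 (2001), Ch. 11 (D. Roy), §2.1–2.3, §4. [NesterenkoPhilippon2001]
* P. Philippon, *Lemmes de zéros dans les groupes algébriques commutatifs*, Bull. Soc. Math.
  France 114 (1986), 355–383, §3, §5. [Philippon1986]
* H. Matsumura, *Commutative Ring Theory* (1986), Thm 5.6 (dimension formula). [Matsumura1987]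
-/

noncomputable section

open MvPolynomial

namespace Literature.NumberTheory.Transcendental

namespace GaGm

variable {n : ℕ}

/-! ### Box polynomials -/

/-- The exponents in the box `[0, tD₀] × [0, tD₁]ⁿ`. [folklore] -/
def boxSet (D₀ D₁ t : ℕ) : Set (Fin (n + 1) →₀ ℕ) :=
  {s | s 0 ≤ t * D₀ ∧ ∀ h : Fin n, s h.succ ≤ t * D₁}

/-- The box polynomials `Box(t) = {P ; deg_X P ≤ tD₀, deg_{Y_h} P ≤ tD₁}` as a `ℂ`-subspace of
`ℂ[X, Y₁, …, Y_n]`: the degree-`t` piece of the homogeneous coordinate ring of the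
Segre–Veronese embedding of `(ℙ¹)ⁿ⁺¹` by `𝒪(D₀, D₁, …, D₁)`. [folklore] -/
def Box (D₀ D₁ t : ℕ) : Submodule ℂ (MvPolynomial (Fin (n + 1)) ℂ) :=
  restrictSupport ℂ (boxSet (n := n) D₀ D₁ t)

/-- Membership in `Box(t)` in terms of partial degrees. [folklore] -/
theorem mem_Box_iff {D₀ D₁ t : ℕ} {P : MvPolynomial (Fin (n + 1)) ℂ} :
    P ∈ Box D₀ D₁ t ↔ P.degreeOf 0 ≤ t * D₀ ∧ ∀ h : Fin n, P.degreeOf h.succ ≤ t * D₁ := by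
  rw [Box, mem_restrictSupport_iff]
  simp only [degreeOf_le_iff, boxSet]
  constructor
  · intro h
    exact ⟨fun s hs => (h hs).1, fun i s hs => (h hs).2 i⟩
  · rintro ⟨h0, h1⟩ s hs
    exact ⟨h0 s hs, fun i => h1 i s hs⟩

/-- The boxes increase with `t`. [folklore] -/
theorem Box_mono {D₀ D₁ t t' : ℕ} (h : t ≤ t') : Box (n := n) D₀ D₁ t ≤ Box D₀ D₁ t' := by
  refine restrictSupport_mono (R := ℂ) ?_
  rintro s ⟨h0, h1⟩
  exact ⟨h0.trans (Nat.mul_le_mul_right _ h), fun i => (h1 i).trans (Nat.mul_le_mul_right _ h)⟩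

/-- Constants are box polynomials. [folklore] -/
theorem C_mem_Box (D₀ D₁ t : ℕ) (c : ℂ) : (C c : MvPolynomial (Fin (n + 1)) ℂ) ∈ Box D₀ D₁ t := by
  rw [mem_Box_iff]
  refine ⟨?_, fun h => ?_⟩ <;> simp [degreeOf_C]

/-- `1 ∈ Box(t)`. [folklore] -/
theorem one_mem_Box (D₀ D₁ t : ℕ) : (1 : MvPolynomial (Fin (n + 1)) ℂ) ∈ Box D₀ D₁ t := by
  simpa using C_mem_Box (n := n) D₀ D₁ t 1

/-- A polynomial all of whose partial degrees vanish is a constant. [folklore] -/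
theorem eq_C_of_degreeOf_eq_zero {P : MvPolynomial (Fin (n + 1)) ℂ} (h : ∀ i, P.degreeOf i = 0) :
    P = C (P.coeff 0) := by
  rw [← totalDegree_eq_zero_iff_eq_C]
  refine Nat.eq_zero_of_le_zero (Finset.sup_le fun s hs => ?_)
  have hs0 : s = 0 := by
    ext i
    have := monomial_le_degreeOf i hs
    rw [h i] at this
    simpa using this
  simp [hs0]

/-- The variables lie in `Box(1)` when `D₀, D₁ ≥ 1`. [folklore] -/
theorem X_mem_Box_one {D₀ D₁ : ℕ} (hD₀ : 1 ≤ D₀) (hD₁ : 1 ≤ D₁) (i : Fin (n + 1)) :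
    (X i : MvPolynomial (Fin (n + 1)) ℂ) ∈ Box D₀ D₁ 1 := by
  classical
  rw [mem_Box_iff]
  refine ⟨?_, fun h => ?_⟩
  · rw [degreeOf_X]; split_ifs <;> omega
  · rw [degreeOf_X]; split_ifs <;> omega

/-- Products of box polynomials: `Box(s) · Box(t) ⊆ Box(s + t)`. [folklore] -/
theorem mul_mem_Box {D₀ D₁ s t : ℕ} {P Q : MvPolynomial (Fin (n + 1)) ℂ}
    (hP : P ∈ Box D₀ D₁ s) (hQ : Q ∈ Box D₀ D₁ t) : P * Q ∈ Box D₀ D₁ (s + t) := by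
  rw [mem_Box_iff] at hP hQ ⊢
  refine ⟨(degreeOf_mul_le _ _ _).trans ?_, fun h => (degreeOf_mul_le _ _ _).trans ?_⟩
  · have := hP.1; have := hQ.1; nlinarith
  · have := hP.2 h; have := hQ.2 h; nlinarith

/-- The exponent box splits: an exponent in the `(t+1)`-box is the sum of one in the `t`-box and
one in the `1`-box. [folklore] -/
theorem boxSet_succ_split {D₀ D₁ t : ℕ} {s : Fin (n + 1) →₀ ℕ} (hs : s ∈ boxSet (n := n) D₀ D₁ (t + 1)) :
    ∃ s₁ ∈ boxSet (n := n) D₀ D₁ 1, ∃ s' ∈ boxSet (n := n) D₀ D₁ t, s = s' + s₁ := by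
  classical
  -- `s₁ i = min (s i) (bound i)`
  let bd : Fin (n + 1) → ℕ := Fin.cons D₀ (fun _ => D₁)
  let s₁ : Fin (n + 1) →₀ ℕ := Finsupp.onFinset Finset.univ (fun i => min (s i) (bd i)) (by simp)
  let s' : Fin (n + 1) →₀ ℕ := Finsupp.onFinset Finset.univ (fun i => s i - min (s i) (bd i)) (by simp)
  obtain ⟨h0, h1⟩ := hs
  refine ⟨s₁, ⟨?_, fun h => ?_⟩, s', ⟨?_, fun h => ?_⟩, ?_⟩
  · simp [s₁, bd]
  · simp [s₁, bd]
  · simp only [s', Finsupp.onFinset_apply, bd, Fin.cons_zero]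
    have e : (t + 1) * D₀ = t * D₀ + D₀ := by ring
    rw [e] at h0
    omega
  · simp only [s', Finsupp.onFinset_apply, bd, Fin.cons_succ]
    have := h1 h
    have e : (t + 1) * D₁ = t * D₁ + D₁ := by ring
    rw [e] at this
    omega
  · ext i
    simp only [s', s₁, Finsupp.coe_add, Pi.add_apply, Finsupp.onFinset_apply]
    omega

/-- **`Box(1)^t = Box(t)`** (as subspaces): the box filtration is generated in degree one — the
Segre–Veronese coordinate ring is standard graded. [folklore] -/
theorem Box_one_pow (D₀ D₁ t : ℕ) : Box (n := n) D₀ D₁ 1 ^ t = Box D₀ D₁ t := by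
  classical
  induction t with
  | zero =>
    rw [pow_zero]
    apply le_antisymm
    · intro P hP
      obtain ⟨c, rfl⟩ := Submodule.mem_one.mp hP
      exact C_mem_Box _ _ _ c
    · intro P hP
      rw [mem_Box_iff] at hP
      simp only [zero_mul, Nat.le_zero] at hP
      have hC : P = C (P.coeff 0) :=
        eq_C_of_degreeOf_eq_zero fun i => Fin.cases hP.1 (fun h => hP.2 h) i
      rw [hC]
      exact Submodule.mem_one.mpr ⟨P.coeff 0, rfl⟩
  | succ t ih =>
    rw [pow_succ, ih]
    apply le_antisymm
    · rw [Submodule.mul_le]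
      intro P hP Q hQ
      exact mul_mem_Box hP hQ
    · -- monomials of the `(t+1)`-box are products
      rw [Box, restrictSupport_eq_span, Submodule.span_le]
      rintro _ ⟨s, hs, rfl⟩
      obtain ⟨s₁, hs₁, s', hs', rfl⟩ := boxSet_succ_split hs
      change (monomial (s' + s₁) (1 : ℂ) : MvPolynomial (Fin (n + 1)) ℂ) ∈ _
      rw [show (monomial (s' + s₁) (1 : ℂ) : MvPolynomial (Fin (n + 1)) ℂ) =
        monomial s' 1 * monomial s₁ 1 by rw [monomial_mul, one_mul]]
      refine Submodule.mul_mem_mul ?_ ?_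
      · exact (monomial_mem_restrictSupport ℂ).mpr (Or.inl hs')
      · exact (monomial_mem_restrictSupport ℂ).mpr (Or.inl hs₁)

/-- The exponent box is equivalent to `Fin (tD₀+1) × (Fin n → Fin (tD₁+1))`. [folklore] -/
def boxSetEquiv (D₀ D₁ t : ℕ) :
    ↥(boxSet (n := n) D₀ D₁ t) ≃ Fin (t * D₀ + 1) × (Fin n → Fin (t * D₁ + 1)) where
  toFun s := (⟨s.1 0, Nat.lt_succ_of_le s.2.1⟩, fun h => ⟨s.1 h.succ, Nat.lt_succ_of_le (s.2.2 h)⟩)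
  invFun p := ⟨Finsupp.equivFunOnFinite.symm (Fin.cons (p.1 : ℕ) (fun h => (p.2 h : ℕ))),
    ⟨by simpa using Nat.le_of_lt_succ p.1.2, fun h => by simpa using Nat.le_of_lt_succ (p.2 h).2⟩⟩
  left_inv s := by
    apply Subtype.ext
    ext i
    refine Fin.cases ?_ (fun h => ?_) i <;> simp
  right_inv p := by
    ext <;> simp

/-- **`dim Box(t) = (tD₀ + 1)(tD₁ + 1)ⁿ`**: the box monomials form a basis. [folklore] -/
theorem finrank_Box (D₀ D₁ t : ℕ) :
    Module.finrank ℂ ↥(Box (n := n) D₀ D₁ t) = (t * D₀ + 1) * (t * D₁ + 1) ^ n := by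
  unfold Box
  rw [Module.finrank_eq_nat_card_basis (basisRestrictSupport ℂ (boxSet (n := n) D₀ D₁ t)),
    Nat.card_congr (boxSetEquiv D₀ D₁ t)]
  simp [Nat.card_eq_fintype_card, Fintype.card_prod, Fintype.card_fin, Fintype.card_pi]

/-- `Box(1)` contains the variables, hence generates the polynomial ring. [folklore] -/
theorem adjoin_Box_one {D₀ D₁ : ℕ} (hD₀ : 1 ≤ D₀) (hD₁ : 1 ≤ D₁) :
    Algebra.adjoin ℂ (Box (n := n) D₀ D₁ 1 : Set (MvPolynomial (Fin (n + 1)) ℂ)) = ⊤ := by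
  refine top_le_iff.mp ?_
  rw [← MvPolynomial.adjoin_range_X]
  exact Algebra.adjoin_mono (by rintro _ ⟨i, rfl⟩; exact X_mem_Box_one hD₀ hD₁ i)

/-! ### Zero sets in `G(ℂ) = ℂ × (ℂˣ)ⁿ` and vanishing ideals -/

/-- The zero set in `G(ℂ)` of a set of affine polynomials. [folklore] -/
def zeroSet (F : Set (MvPolynomial (Fin (n + 1)) ℂ)) : Set (GaGm n) :=
  {g | ∀ P ∈ F, evalAt P g = 0}

/-- `evalAt · g` is a ring homomorphism (evaluation at the affine coordinates of `g`). [folklore] -/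
theorem evalAt_eq_eval (P : MvPolynomial (Fin (n + 1)) ℂ) (g : GaGm n) :
    evalAt P g = MvPolynomial.eval (coord g) P := rfl

/-- The ideal of affine polynomials vanishing on a subset of `G(ℂ)`. [folklore] -/
def vanishing (X : Set (GaGm n)) : Ideal (MvPolynomial (Fin (n + 1)) ℂ) where
  carrier := {P | ∀ g ∈ X, evalAt P g = 0}
  zero_mem' := fun g _ => by simp [evalAt]
  add_mem' := fun {P Q} hP hQ g hg => by
    have h1 := hP g hg
    have h2 := hQ g hg
    rw [evalAt_eq_eval] at h1 h2 ⊢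
    rw [map_add, h1, h2, add_zero]
  smul_mem' := fun c {P} hP g hg => by
    have h1 := hP g hg
    rw [evalAt_eq_eval] at h1 ⊢
    rw [smul_eq_mul, map_mul, h1, mul_zero]

/-- Membership in the vanishing ideal. [folklore] -/
theorem mem_vanishing_iff {X : Set (GaGm n)} {P : MvPolynomial (Fin (n + 1)) ℂ} :
    P ∈ vanishing X ↔ ∀ g ∈ X, evalAt P g = 0 := Iff.rfl

/-- Membership in a zero set. [folklore] -/
theorem mem_zeroSet_iff {F : Set (MvPolynomial (Fin (n + 1)) ℂ)} {g : GaGm n} :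
    g ∈ zeroSet F ↔ ∀ P ∈ F, evalAt P g = 0 := Iff.rfl

/-- `Z` is antitone. [folklore] -/
theorem zeroSet_antitone {F F' : Set (MvPolynomial (Fin (n + 1)) ℂ)} (h : F ⊆ F') :
    zeroSet (n := n) F' ⊆ zeroSet F := fun _ hg P hP => hg P (h hP)

/-- `𝔍` is antitone. [folklore] -/
theorem vanishing_antitone {X Y : Set (GaGm n)} (h : X ⊆ Y) : vanishing Y ≤ vanishing X :=
  fun _ hP g hg => hP g (h hg)

/-- `X ⊆ Z(𝔍(X))`. [folklore] -/
theorem subset_zeroSet_vanishing (X : Set (GaGm n)) : X ⊆ zeroSet (vanishing X) :=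
  fun _ hg _ hP => hP _ hg

/-- `F ⊆ 𝔍(Z(F))`. [folklore] -/
theorem subset_vanishing_zeroSet (F : Set (MvPolynomial (Fin (n + 1)) ℂ)) :
    F ⊆ vanishing (zeroSet (n := n) F) := fun _ hP _ hg => hg _ hP

/-- The zero set of a set is the zero set of the ideal it generates. [folklore] -/
theorem zeroSet_span (F : Set (MvPolynomial (Fin (n + 1)) ℂ)) :
    zeroSet (n := n) (Ideal.span F) = zeroSet F := by
  refine Set.Subset.antisymm (zeroSet_antitone Ideal.subset_span) fun g hg P hP => ?_
  have h : Ideal.span F ≤ vanishing {g} := Ideal.span_le.mpr fun Q hQ g' hg' => by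
    rw [Set.mem_singleton_iff.mp hg']; exact hg Q hQ
  exact h hP g rfl

/-- `Z(𝔍(Z(F))) = Z(F)`. [folklore] -/
theorem zeroSet_vanishing_zeroSet (F : Set (MvPolynomial (Fin (n + 1)) ℂ)) :
    zeroSet (vanishing (zeroSet (n := n) F)) = zeroSet F :=
  Set.Subset.antisymm (zeroSet_antitone (subset_vanishing_zeroSet F)) (subset_zeroSet_vanishing _)

/-- `G`-closed subsets: zero sets of (their own) vanishing ideals. [folklore] -/
def IsClosedG (X : Set (GaGm n)) : Prop := zeroSet (vanishing X) = X

/-- Zero sets are closed. [folklore] -/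
theorem isClosedG_zeroSet (F : Set (MvPolynomial (Fin (n + 1)) ℂ)) : IsClosedG (zeroSet (n := n) F) :=
  zeroSet_vanishing_zeroSet F

/-- A closed set is the zero set of its vanishing ideal. [folklore] -/
theorem IsClosedG.eq {X : Set (GaGm n)} (h : IsClosedG X) : zeroSet (vanishing X) = X := h

/-- The zero set of a finite intersection of ideals is the union of the zero sets. [folklore] -/
theorem zeroSet_inf (I J : Ideal (MvPolynomial (Fin (n + 1)) ℂ)) :
    zeroSet (n := n) ↑(I ⊓ J) = zeroSet I ∪ zeroSet J := by
  ext g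
  constructor
  · intro hg
    by_contra h
    rw [Set.mem_union, not_or] at h
    obtain ⟨hI, hJ⟩ := h
    simp only [mem_zeroSet_iff, not_forall] at hI hJ
    obtain ⟨P, hP, hPg⟩ := hI
    obtain ⟨Q, hQ, hQg⟩ := hJ
    have hPQ : P * Q ∈ I ⊓ J := ⟨I.mul_mem_right _ hP, J.mul_mem_left _ hQ⟩
    have := hg _ hPQ
    rw [evalAt_eq_eval, map_mul] at this
    exact mul_ne_zero hPg hQg this
  · rintro (h | h) P hP
    · exact h P hP.1
    · exact h P hP.2

/-- The zero set of a finite infimum of ideals is the union of the zero sets. [folklore] -/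
theorem zeroSet_finset_inf {ι : Type*} (s : Finset ι) (I : ι → Ideal (MvPolynomial (Fin (n + 1)) ℂ)) :
    zeroSet (n := n) ↑(s.inf I) = ⋃ i ∈ s, zeroSet (I i) := by
  classical
  induction s using Finset.induction_on with
  | empty =>
    ext g
    simp only [Finset.inf_empty, Finset.notMem_empty, Set.iUnion_of_empty, Set.iUnion_empty,
      Set.mem_empty_iff_false, iff_false]
    intro hg
    have := hg 1 (by simp)
    simp [evalAt_eq_eval] at this
  | insert a s ha ih =>
    rw [Finset.inf_insert, zeroSet_inf, ih]
    simp

/-- Closed sets are stable under finite unions. [folklore] -/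
theorem IsClosedG.union {X Y : Set (GaGm n)} (hX : IsClosedG X) (hY : IsClosedG Y) : IsClosedG (X ∪ Y) := by
  have h : X ∪ Y = zeroSet ↑(vanishing X ⊓ vanishing Y) := by rw [zeroSet_inf, hX.eq, hY.eq]
  rw [h]; exact isClosedG_zeroSet _

/-- Closed sets are stable under arbitrary intersections. [folklore] -/
theorem IsClosedG.iInter {ι : Sort*} {X : ι → Set (GaGm n)} (hX : ∀ i, IsClosedG (X i)) :
    IsClosedG (⋂ i, X i) := by
  have h : (⋂ i, X i) = zeroSet (⋃ i, (vanishing (X i) : Set (MvPolynomial (Fin (n + 1)) ℂ))) := by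
    ext g
    simp only [Set.mem_iInter, mem_zeroSet_iff, Set.mem_iUnion, forall_exists_index]
    constructor
    · intro hg P i hP
      exact hP g (hg i)
    · intro hg i
      rw [← (hX i).eq]
      exact fun P hP => hg P i hP
  rw [h]; exact isClosedG_zeroSet _

/-- Closed sets are stable under binary intersections. [folklore] -/
theorem IsClosedG.inter {X Y : Set (GaGm n)} (hX : IsClosedG X) (hY : IsClosedG Y) : IsClosedG (X ∩ Y) := by
  rw [Set.inter_eq_iInter]
  exact IsClosedG.iInter fun b => by cases b <;> assumption

/-! ### The Nullstellensatz in `G(ℂ)` -/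

/-- The product `u = Y₁ ⋯ Y_n` of the torus coordinates; `G(ℂ)` is the locus `u ≠ 0` of affine
space. [folklore] -/
def torusUnit (n : ℕ) : MvPolynomial (Fin (n + 1)) ℂ := ∏ h : Fin n, X h.succ

/-- `u = Y₁⋯Y_n` does not vanish on `G(ℂ)`. [folklore] -/
theorem evalAt_torusUnit_ne_zero (g : GaGm n) : evalAt (torusUnit n) g ≠ 0 := by
  simp only [torusUnit, evalAt_eq_eval, map_prod, MvPolynomial.eval_X, coord_succ]
  exact Finset.prod_ne_zero_iff.mpr fun h _ => (g.2 h).ne_zero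

/-- Every point of affine space with non-zero torus coordinates is a point of `G(ℂ)`. [folklore] -/
theorem exists_coord_eq {v : Fin (n + 1) → ℂ} (hv : ∀ h : Fin n, v h.succ ≠ 0) :
    ∃ g : GaGm n, coord g = v :=
  ⟨(Multiplicative.ofAdd (v 0), fun h => Units.mk0 (v h.succ) (hv h)), by
    funext i; refine Fin.cases ?_ (fun h => ?_) i <;> simp⟩

/-- **Nullstellensatz in `G(ℂ)`**: `P` vanishes on the zero set of the ideal `I` in `G(ℂ)` iff
some power of `P · u` lies in `I` (`u = Y₁⋯Y_n`): Hilbert's Nullstellensatz on the principal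
open set `u ≠ 0`. [folklore] -/
theorem mem_vanishing_zeroSet_iff (I : Ideal (MvPolynomial (Fin (n + 1)) ℂ))
    (P : MvPolynomial (Fin (n + 1)) ℂ) :
    P ∈ vanishing (zeroSet (n := n) ↑I) ↔ ∃ k, (P * torusUnit n) ^ k ∈ I := by
  constructor
  · intro hP
    have h : P * torusUnit n ∈ MvPolynomial.vanishingIdeal ℂ (MvPolynomial.zeroLocus ℂ I) := by
      rw [MvPolynomial.mem_vanishingIdeal_iff]
      intro v hv
      rw [map_mul]
      by_cases hv0 : ∀ h : Fin n, v h.succ ≠ 0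
      · obtain ⟨g, rfl⟩ := exists_coord_eq hv0
        have hg : g ∈ zeroSet (n := n) ↑I := fun Q hQ =>
          (MvPolynomial.mem_zeroLocus_iff.mp hv) Q hQ
        have := hP g hg
        rw [evalAt_eq_eval] at this
        change MvPolynomial.eval (coord g) P * MvPolynomial.eval (coord g) (torusUnit n) = 0
        rw [this, zero_mul]
      · push Not at hv0
        obtain ⟨h, hh⟩ := hv0
        have : MvPolynomial.aeval v (torusUnit n) = 0 := by
          change MvPolynomial.eval v (torusUnit n) = 0
          rw [torusUnit, map_prod]
          exact Finset.prod_eq_zero (Finset.mem_univ h) (by simpa using hh)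
        rw [this, mul_zero]
    rw [MvPolynomial.vanishingIdeal_zeroLocus_eq_radical] at h
    exact h
  · rintro ⟨k, hk⟩ g hg
    have h := hg _ hk
    rw [evalAt_eq_eval, map_pow, map_mul] at h
    have h' := eq_zero_of_pow_eq_zero h
    rcases mul_eq_zero.mp h' with h'' | h''
    · exact h''
    · exact absurd h'' (evalAt_torusUnit_ne_zero g)

/-! ### Radical and saturated: vanishing ideals; irreducible closed sets -/

/-- Vanishing ideals are radical. [folklore] -/
theorem vanishing_isRadical (X : Set (GaGm n)) : (vanishing X).IsRadical := by
  intro P ⟨k, hk⟩ g hg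
  have h := hk g hg
  rw [evalAt_eq_eval, map_pow] at h
  exact eq_zero_of_pow_eq_zero h

/-- Vanishing ideals are saturated with respect to `u = Y₁⋯Y_n`. [folklore] -/
theorem mem_vanishing_of_mul_torusUnit {X : Set (GaGm n)} {P : MvPolynomial (Fin (n + 1)) ℂ}
    (h : P * torusUnit n ∈ vanishing X) : P ∈ vanishing X := by
  intro g hg
  have h' := h g hg
  rw [evalAt_eq_eval, map_mul] at h'
  rcases mul_eq_zero.mp h' with h'' | h''
  · exact h''
  · exact absurd h'' (evalAt_torusUnit_ne_zero g)

/-- `𝔍(∅) = (1)`. [folklore] -/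
theorem vanishing_empty : vanishing (∅ : Set (GaGm n)) = ⊤ :=
  eq_top_iff.mpr fun _ _ _ hg => absurd hg (Set.notMem_empty _)

/-- Irreducible closed subsets of `G(ℂ)`: closed, with prime vanishing ideal. [folklore] -/
def IsIrred (X : Set (GaGm n)) : Prop := IsClosedG X ∧ (vanishing X).IsPrime

/-- Irreducible closed sets are closed. [folklore] -/
theorem IsIrred.isClosedG {X : Set (GaGm n)} (h : IsIrred X) : IsClosedG X := h.1

/-- Irreducible closed sets have prime vanishing ideal. [folklore] -/
theorem IsIrred.isPrime {X : Set (GaGm n)} (h : IsIrred X) : (vanishing X).IsPrime := h.2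

/-- Irreducible closed sets are non-empty. [folklore] -/
theorem IsIrred.nonempty {X : Set (GaGm n)} (h : IsIrred X) : X.Nonempty := by
  by_contra h'
  rw [Set.not_nonempty_iff_eq_empty] at h'
  have := h.isPrime.ne_top
  rw [h', vanishing_empty] at this
  exact this rfl

/-- An irreducible closed set contained in the union of two closed sets lies in one of them.
[folklore] -/
theorem IsIrred.subset_or_subset {X Y Z : Set (GaGm n)} (hX : IsIrred X) (hY : IsClosedG Y)
    (hZ : IsClosedG Z) (h : X ⊆ Y ∪ Z) : X ⊆ Y ∨ X ⊆ Z := by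
  by_contra hc
  rw [not_or, Set.not_subset, Set.not_subset] at hc
  obtain ⟨⟨x₁, hx₁X, hx₁Y⟩, ⟨x₂, hx₂X, hx₂Z⟩⟩ := hc
  rw [← hY.eq] at hx₁Y
  rw [← hZ.eq] at hx₂Z
  simp only [mem_zeroSet_iff, not_forall] at hx₁Y hx₂Z
  obtain ⟨P, hP, hP₁⟩ := hx₁Y
  obtain ⟨Q, hQ, hQ₂⟩ := hx₂Z
  have hPQ : P * Q ∈ vanishing X := by
    intro g hg
    rw [evalAt_eq_eval, map_mul]
    rcases h hg with hgY | hgZ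
    · have : evalAt P g = 0 := by rw [← hY.eq] at hgY; exact hgY P hP
      rw [evalAt_eq_eval] at this; rw [this, zero_mul]
    · have : evalAt Q g = 0 := by rw [← hZ.eq] at hgZ; exact hgZ Q hQ
      rw [evalAt_eq_eval] at this; rw [this, mul_zero]
  rcases hX.isPrime.mem_or_mem hPQ with hPX | hQX
  · exact hP₁ (hPX x₁ hx₁X)
  · exact hQ₂ (hQX x₂ hx₂X)

/-- An irreducible closed set contained in a finite union of closed sets lies in one of them.
[folklore] -/
theorem IsIrred.exists_subset_of_subset_biUnion {ι : Type*} {X : Set (GaGm n)} (hX : IsIrred X)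
    (s : Finset ι) (Y : ι → Set (GaGm n)) (hY : ∀ i ∈ s, IsClosedG (Y i))
    (h : X ⊆ ⋃ i ∈ s, Y i) : ∃ i ∈ s, X ⊆ Y i := by
  classical
  induction s using Finset.induction_on with
  | empty =>
    exfalso
    obtain ⟨x, hx⟩ := hX.nonempty
    simpa using h hx
  | insert a s ha ih =>
    rw [Finset.set_biUnion_insert] at h
    have hU : IsClosedG (⋃ i ∈ s, Y i) := by
      have e : (⋃ i ∈ s, Y i) = zeroSet ↑(s.inf fun i => vanishing (Y i)) := by
        rw [zeroSet_finset_inf]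
        refine Set.iUnion₂_congr fun i hi => ?_
        exact ((hY i (Finset.mem_insert_of_mem hi)).eq).symm
      rw [e]; exact isClosedG_zeroSet _
    rcases hX.subset_or_subset (hY a (Finset.mem_insert_self a s)) hU h with h' | h'
    · exact ⟨a, Finset.mem_insert_self a s, h'⟩
    · obtain ⟨i, hi, h''⟩ := ih (fun i hi => hY i (Finset.mem_insert_of_mem hi)) h'
      exact ⟨i, Finset.mem_insert_of_mem hi, h''⟩

/-! ### Irreducible components = minimal primes of the vanishing ideal -/

/-- Minimal primes of a radical `u`-saturated ideal do not contain `u`. [folklore] -/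
theorem torusUnit_notMem_of_mem_minimalPrimes {I : Ideal (MvPolynomial (Fin (n + 1)) ℂ)}
    (hrad : I.IsRadical) (hsat : ∀ P, P * torusUnit n ∈ I → P ∈ I)
    {𝔮 : Ideal (MvPolynomial (Fin (n + 1)) ℂ)} (h𝔮 : 𝔮 ∈ I.minimalPrimes) : torusUnit n ∉ 𝔮 := by
  classical
  intro hu
  haveI := h𝔮.isPrime
  have hfin := Ideal.finite_minimalPrimes_of_isNoetherianRing _ I
  -- `f ∈ ⋂ (other minimal primes) \ 𝔮`
  set others := hfin.toFinset.erase 𝔮 with hothers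
  have hnot : ¬ (others.inf id ≤ 𝔮) := by
    rw [(h𝔮.isPrime).inf_le']
    rintro ⟨𝔮', h𝔮', hle⟩
    rw [hothers, Finset.mem_erase, Set.Finite.mem_toFinset] at h𝔮'
    have : 𝔮' = 𝔮 := le_antisymm hle (h𝔮.2 ⟨h𝔮'.2.isPrime, h𝔮'.2.le⟩ hle)
    exact h𝔮'.1 this
  obtain ⟨f, hf, hf𝔮⟩ := Set.not_subset.mp hnot
  -- `f u ∈ ⋂ all minimal primes = I`
  have hfu : f * torusUnit n ∈ I := by
    rw [← hrad.radical, ← Ideal.sInf_minimalPrimes, Submodule.mem_sInf]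
    intro 𝔮' h𝔮'
    by_cases heq : 𝔮' = 𝔮
    · rw [heq]; exact 𝔮.mul_mem_left _ hu
    · have hmem : 𝔮' ∈ others := by
        rw [hothers, Finset.mem_erase, Set.Finite.mem_toFinset]; exact ⟨heq, h𝔮'⟩
      exact Ideal.mul_mem_right _ 𝔮' ((Finset.inf_le (f := id) hmem) hf)
  exact hf𝔮 (h𝔮.le (hsat f hfu))

/-- The vanishing ideal of the zero set of a prime not containing `u` is the prime itself
(Nullstellensatz). [folklore] -/
theorem vanishing_zeroSet_eq_of_isPrime {𝔮 : Ideal (MvPolynomial (Fin (n + 1)) ℂ)} (h𝔮 : 𝔮.IsPrime)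
    (hu : torusUnit n ∉ 𝔮) : vanishing (zeroSet (n := n) ↑𝔮) = 𝔮 := by
  refine le_antisymm (fun P hP => ?_) (subset_vanishing_zeroSet _)
  obtain ⟨k, hk⟩ := (mem_vanishing_zeroSet_iff 𝔮 P).mp hP
  exact ((h𝔮.mem_or_mem (h𝔮.mem_of_pow_mem k hk)).resolve_right hu)

/-- **Components.** For a closed `X`, the zero set of a minimal prime `𝔮` of `𝔍(X)` is an
irreducible closed subset of `X` with vanishing ideal `𝔮`. [folklore] -/
theorem isIrred_zeroSet_of_mem_minimalPrimes {X : Set (GaGm n)}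
    {𝔮 : Ideal (MvPolynomial (Fin (n + 1)) ℂ)} (h𝔮 : 𝔮 ∈ (vanishing X).minimalPrimes) :
    IsIrred (zeroSet (n := n) ↑𝔮) ∧ vanishing (zeroSet (n := n) ↑𝔮) = 𝔮 ∧
      zeroSet (n := n) ↑𝔮 ⊆ zeroSet ↑(vanishing X) := by
  have hu := torusUnit_notMem_of_mem_minimalPrimes (vanishing_isRadical X)
    (fun P => mem_vanishing_of_mul_torusUnit) h𝔮
  have hv := vanishing_zeroSet_eq_of_isPrime h𝔮.isPrime hu
  refine ⟨⟨isClosedG_zeroSet _, ?_⟩, hv, zeroSet_antitone h𝔮.le⟩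
  rw [hv]; exact h𝔮.isPrime

/-- A closed set is the (finite) union of its components. [folklore] -/
theorem IsClosedG.eq_biUnion_minimalPrimes {X : Set (GaGm n)} (hX : IsClosedG X) :
    X = ⋃ 𝔮 ∈ (Ideal.finite_minimalPrimes_of_isNoetherianRing _ (vanishing X)).toFinset,
      zeroSet (n := n) (𝔮 : Set (MvPolynomial (Fin (n + 1)) ℂ)) := by
  have h := zeroSet_finset_inf (n := n)
    (Ideal.finite_minimalPrimes_of_isNoetherianRing _ (vanishing X)).toFinset id
  simp only [id] at h
  rw [← h, Finset.inf_id_eq_sInf, Set.Finite.coe_toFinset, Ideal.sInf_minimalPrimes,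
    (vanishing_isRadical X).radical, hX.eq]

/-- An irreducible closed subset of `X` lies in some component of `X`. [folklore] -/
theorem IsIrred.exists_minimalPrimes_subset {X Y : Set (GaGm n)} (hY : IsIrred Y) (hYX : Y ⊆ X) :
    ∃ 𝔮 ∈ (vanishing X).minimalPrimes, Y ⊆ zeroSet (n := n) ↑𝔮 := by
  haveI := hY.isPrime
  obtain ⟨𝔮, h𝔮, hle⟩ := Ideal.exists_minimalPrimes_le (vanishing_antitone hYX)
  refine ⟨𝔮, h𝔮, ?_⟩
  rw [← hY.isClosedG.eq]
  exact zeroSet_antitone hle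

/-- Distinct components are not contained in one another. [folklore] -/
theorem eq_of_zeroSet_subset_of_mem_minimalPrimes {X : Set (GaGm n)}
    {𝔮 𝔮' : Ideal (MvPolynomial (Fin (n + 1)) ℂ)} (h𝔮 : 𝔮 ∈ (vanishing X).minimalPrimes)
    (h𝔮' : 𝔮' ∈ (vanishing X).minimalPrimes) (h : zeroSet (n := n) ↑𝔮 ⊆ zeroSet ↑𝔮') : 𝔮 = 𝔮' := by
  have h1 := (isIrred_zeroSet_of_mem_minimalPrimes h𝔮).2.1
  have h2 := (isIrred_zeroSet_of_mem_minimalPrimes h𝔮').2.1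
  have hle : 𝔮' ≤ 𝔮 := by rw [← h1, ← h2]; exact vanishing_antitone h
  exact le_antisymm (h𝔮.2 ⟨h𝔮'.isPrime, h𝔮'.le⟩ hle) hle

/-! ### The whole group is irreducible -/

/-- A polynomial vanishing on all of `G(ℂ) = ℂ × (ℂˣ)ⁿ` is zero. [folklore] -/
theorem vanishing_univ : vanishing (Set.univ : Set (GaGm n)) = ⊥ := by
  refine (Submodule.eq_bot_iff _).mpr fun P hP => ?_
  have h : P * torusUnit n = 0 := by
    apply MvPolynomial.funext
    intro v
    rw [map_zero, map_mul]
    by_cases hv0 : ∀ h : Fin n, v h.succ ≠ 0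
    · obtain ⟨g, rfl⟩ := exists_coord_eq hv0
      have := hP g (Set.mem_univ g)
      rw [evalAt_eq_eval] at this
      rw [this, zero_mul]
    · push Not at hv0
      obtain ⟨h, hh⟩ := hv0
      have : MvPolynomial.eval v (torusUnit n) = 0 := by
        rw [torusUnit, map_prod]
        exact Finset.prod_eq_zero (Finset.mem_univ h) (by simpa using hh)
      rw [this, mul_zero]
  rcases mul_eq_zero.mp h with h' | h'
  · exact h'
  · exfalso
    have h1 := evalAt_torusUnit_ne_zero (1 : GaGm n)
    rw [h'] at h1
    simp [evalAt] at h1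

/-- `G(ℂ)` is closed. [folklore] -/
theorem isClosedG_univ : IsClosedG (Set.univ : Set (GaGm n)) :=
  Set.eq_univ_of_univ_subset (subset_zeroSet_vanishing _)

/-- `G(ℂ)` is irreducible. [folklore] -/
theorem isIrred_univ : IsIrred (Set.univ : Set (GaGm n)) :=
  ⟨isClosedG_univ, by rw [vanishing_univ]; exact Ideal.isPrime_bot⟩

/-- Two polynomials with the same values on `G(ℂ)` are equal. [folklore] -/
theorem eq_of_forall_evalAt_eq {P Q : MvPolynomial (Fin (n + 1)) ℂ} (h : ∀ g : GaGm n, evalAt P g = evalAt Q g) :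
    P = Q := by
  have : P - Q ∈ vanishing (Set.univ : Set (GaGm n)) := fun g _ => by
    rw [evalAt_eq_eval, map_sub, ← evalAt_eq_eval, ← evalAt_eq_eval, h g, sub_self]
  rw [vanishing_univ, Submodule.mem_bot, sub_eq_zero] at this
  exact this

/-! ### Dimension -/

/-- The polynomial ring has dimension `n + 1`. [folklore] -/
theorem ringKrullDim_poly : ringKrullDim (MvPolynomial (Fin (n + 1)) ℂ) = (n + 1 : ℕ) := by
  rw [MvPolynomial.ringKrullDim_of_isNoetherianRing, ringKrullDim_eq_zero_of_field,
    Nat.card_eq_fintype_card, Fintype.card_fin, zero_add]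

/-- A proper quotient of the polynomial ring has a natural-number dimension `≤ n + 1`. [folklore] -/
theorem exists_ringKrullDim_quotient_eq {I : Ideal (MvPolynomial (Fin (n + 1)) ℂ)} (hI : I ≠ ⊤) :
    ∃ d : ℕ, ringKrullDim (MvPolynomial (Fin (n + 1)) ℂ ⧸ I) = d ∧ d ≤ n + 1 := by
  have hle : ringKrullDim (MvPolynomial (Fin (n + 1)) ℂ ⧸ I) ≤ (n + 1 : ℕ) := by
    rw [← ringKrullDim_poly]; exact ringKrullDim_quotient_le I
  haveI : Nontrivial (MvPolynomial (Fin (n + 1)) ℂ ⧸ I) := Ideal.Quotient.nontrivial_iff.mpr hI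
  have hge : 0 ≤ ringKrullDim (MvPolynomial (Fin (n + 1)) ℂ ⧸ I) := ringKrullDim_nonneg_of_nontrivial
  generalize hq : ringKrullDim (MvPolynomial (Fin (n + 1)) ℂ ⧸ I) = q at hle hge
  induction q with
  | bot => exact absurd hge (by simp)
  | coe q =>
    induction q with
    | top => exact absurd (top_le_iff.mp (WithBot.coe_le_coe.mp hle)) (ENat.coe_ne_top _)
    | coe d =>
      refine ⟨d, rfl, ?_⟩
      have : ((d : ℕ∞) : WithBot ℕ∞) ≤ ((n + 1 : ℕ) : ℕ∞) := hle
      exact_mod_cast this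

/-- The dimension of a subset of `G(ℂ)`: the Krull dimension of `ℂ[X, Y] ⧸ 𝔍(X)` (and `0` for
the empty set). [folklore] -/
def dimG (X : Set (GaGm n)) : ℕ :=
  ((ringKrullDim (MvPolynomial (Fin (n + 1)) ℂ ⧸ vanishing X)).unbotD 0).toNat

/-- The vanishing ideal of a non-empty set is proper. [folklore] -/
theorem vanishing_ne_top {X : Set (GaGm n)} (hX : X.Nonempty) : vanishing X ≠ ⊤ := by
  obtain ⟨g, hg⟩ := hX
  intro h
  have : (1 : MvPolynomial (Fin (n + 1)) ℂ) ∈ vanishing X := by rw [h]; exact Submodule.mem_top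
  have h1 := this g hg
  simp [evalAt] at h1

/-- For non-empty `X`, `dimG X` is the Krull dimension of `ℂ[X, Y] ⧸ 𝔍(X)`. [folklore] -/
theorem dimG_eq {X : Set (GaGm n)} (hX : X.Nonempty) :
    (dimG X : WithBot ℕ∞) = ringKrullDim (MvPolynomial (Fin (n + 1)) ℂ ⧸ vanishing X) := by
  obtain ⟨d, hd, -⟩ := exists_ringKrullDim_quotient_eq (vanishing_ne_top hX)
  rw [dimG, hd]
  rfl

/-- `dim X ≤ n + 1`. [folklore] -/
theorem dimG_le (X : Set (GaGm n)) : dimG X ≤ n + 1 := by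
  by_cases hX : X.Nonempty
  · obtain ⟨d, hd, hdn⟩ := exists_ringKrullDim_quotient_eq (vanishing_ne_top hX)
    rw [dimG, hd]
    exact hdn
  · rw [Set.not_nonempty_iff_eq_empty] at hX
    rw [dimG, hX, vanishing_empty]
    haveI : Subsingleton (MvPolynomial (Fin (n + 1)) ℂ ⧸ (⊤ : Ideal (MvPolynomial (Fin (n + 1)) ℂ))) :=
      Ideal.Quotient.subsingleton_iff.mpr rfl
    rw [ringKrullDim_eq_bot_of_subsingleton]
    simp

/-- `dim G = n + 1`. [folklore] -/
theorem dimG_univ : dimG (Set.univ : Set (GaGm n)) = n + 1 := by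
  have h := dimG_eq (n := n) (Set.univ_nonempty)
  rw [vanishing_univ, ringKrullDim_eq_of_ringEquiv (RingEquiv.quotientBot _), ringKrullDim_poly] at h
  exact_mod_cast h

/-- Dimension is monotone on closed sets. [folklore] -/
theorem dimG_mono {X Y : Set (GaGm n)} (hYX : Y ⊆ X) : dimG Y ≤ dimG X := by
  by_cases hY : Y.Nonempty
  · have hX : X.Nonempty := hY.mono hYX
    have h := ringKrullDim_le_of_surjective
      (Ideal.Quotient.factor (vanishing_antitone hYX)) (Ideal.Quotient.factor_surjective _)
    rw [← dimG_eq hX, ← dimG_eq hY] at h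
    exact_mod_cast h
  · rw [Set.not_nonempty_iff_eq_empty] at hY
    subst hY
    have : dimG (∅ : Set (GaGm n)) = 0 := by
      rw [dimG, vanishing_empty]
      haveI : Subsingleton (MvPolynomial (Fin (n + 1)) ℂ ⧸ (⊤ : Ideal (MvPolynomial (Fin (n + 1)) ℂ))) :=
        Ideal.Quotient.subsingleton_iff.mpr rfl
      rw [ringKrullDim_eq_bot_of_subsingleton]; simp
    rw [this]; exact Nat.zero_le _

/-- **A proper closed subset of an irreducible closed set has smaller dimension.** [folklore] -/
theorem dimG_lt_of_ssubset {X Y : Set (GaGm n)} (hX : IsIrred X) (hY : IsClosedG Y) (hYne : Y.Nonempty)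
    (hYX : Y ⊂ X) : dimG Y < dimG X := by
  have hle : vanishing X ≤ vanishing Y := vanishing_antitone hYX.subset
  have hne : vanishing X ≠ vanishing Y := by
    intro h
    apply hYX.ne
    rw [← hX.isClosedG.eq, ← hY.eq, h]
  haveI := hX.isPrime
  haveI : IsDomain (MvPolynomial (Fin (n + 1)) ℂ ⧸ vanishing X) := Ideal.Quotient.isDomain _
  set J : Ideal (MvPolynomial (Fin (n + 1)) ℂ ⧸ vanishing X) :=
    (vanishing Y).map (Ideal.Quotient.mk (vanishing X)) with hJ
  have hJ0 : J ≠ ⊥ := by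
    intro h0
    apply hne
    refine le_antisymm hle fun P hP => ?_
    have : Ideal.Quotient.mk (vanishing X) P ∈ J := Ideal.mem_map_of_mem _ hP
    rw [h0, Submodule.mem_bot, Ideal.Quotient.eq_zero_iff_mem] at this
    exact this
  have h1 := Literature.RingTheory.KrullDimension.ringKrullDim_quotient_add_one_le hJ0
  have e := ringKrullDim_eq_of_ringEquiv (DoubleQuot.quotQuotEquivQuotOfLE hle)
  rw [e, ← dimG_eq hYne, ← dimG_eq hX.nonempty] at h1
  have : (dimG Y : WithBot ℕ∞) + 1 = ((dimG Y + 1 : ℕ) : WithBot ℕ∞) := by push_cast; rfl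
  rw [this] at h1
  have h2 : dimG Y + 1 ≤ dimG X := by exact_mod_cast h1
  omega

/-- The zero set of `𝔍(C) + (ℓ)` is `C ∩ Z(ℓ)` for closed `C`. [folklore] -/
theorem inter_zeroSet_singleton_eq {C : Set (GaGm n)} (hC : IsClosedG C) (ℓ : MvPolynomial (Fin (n + 1)) ℂ) :
    C ∩ zeroSet {ℓ} = zeroSet ↑(vanishing C ⊔ Ideal.span {ℓ}) := by
  ext g
  constructor
  · rintro ⟨hgC, hgℓ⟩ P hP
    have hle : vanishing C ⊔ Ideal.span {ℓ} ≤ vanishing {g} := by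
      refine sup_le (vanishing_antitone (Set.singleton_subset_iff.mpr hgC)) ?_
      rw [Ideal.span_le, Set.singleton_subset_iff]
      intro g' hg'
      rw [Set.mem_singleton_iff.mp hg']
      exact hgℓ ℓ rfl
    exact hle hP g rfl
  · intro hg
    refine ⟨?_, fun P hP => ?_⟩
    · rw [← hC.eq]
      exact fun P hP => hg P (Ideal.mem_sup_left hP)
    · rw [Set.mem_singleton_iff.mp hP]
      exact hg ℓ (Ideal.mem_sup_right (Ideal.subset_span rfl))

/-- **Krull's principal ideal theorem in `G(ℂ)`**: every component of a hypersurface section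
`C ∩ Z(ℓ)` of an irreducible closed `C` with `ℓ ∉ 𝔍(C)` has dimension `dim C - 1` (Krull's
Hauptidealsatz plus the dimension formula for affine domains). [folklore] -/
theorem dimG_add_one_of_mem_minimalPrimes_section {C : Set (GaGm n)} (hC : IsIrred C)
    {ℓ : MvPolynomial (Fin (n + 1)) ℂ} (hℓ : ℓ ∉ vanishing C)
    {𝔮 : Ideal (MvPolynomial (Fin (n + 1)) ℂ)}
    (h𝔮 : 𝔮 ∈ (vanishing (C ∩ zeroSet {ℓ})).minimalPrimes) :
    dimG (zeroSet (n := n) ↑𝔮) + 1 = dimG C := by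
  classical
  set J : Ideal (MvPolynomial (Fin (n + 1)) ℂ) := vanishing C ⊔ Ideal.span {ℓ} with hJdef
  have hsec : C ∩ zeroSet {ℓ} = zeroSet ↑J := inter_zeroSet_singleton_eq hC.isClosedG ℓ
  rw [hsec] at h𝔮
  haveI := h𝔮.isPrime
  have hu : torusUnit n ∉ 𝔮 := torusUnit_notMem_of_mem_minimalPrimes (vanishing_isRadical _)
    (fun P => mem_vanishing_of_mul_torusUnit) h𝔮
  -- `𝔮` is a minimal prime of `J` itself
  have hJ𝔮 : J ≤ 𝔮 := (subset_vanishing_zeroSet (n := n) (J : Set _)).trans h𝔮.le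
  have h𝔮J : 𝔮 ∈ J.minimalPrimes := by
    refine ⟨⟨h𝔮.isPrime, hJ𝔮⟩, fun 𝔮' h𝔮' hle => h𝔮.2 ⟨h𝔮'.1, fun P hP => ?_⟩ hle⟩
    obtain ⟨k, hk⟩ := (mem_vanishing_zeroSet_iff J P).mp hP
    have h1 : P * torusUnit n ∈ 𝔮' := h𝔮'.1.mem_of_pow_mem k (h𝔮'.2 hk)
    exact (h𝔮'.1.mem_or_mem h1).resolve_right fun h => hu (hle h)
  -- pass to the affine domain `A = ℂ[X, Y] ⧸ 𝔍(C)`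
  haveI := hC.isPrime
  set A := MvPolynomial (Fin (n + 1)) ℂ ⧸ vanishing C with hA
  haveI : IsDomain A := Ideal.Quotient.isDomain _
  set mk := Ideal.Quotient.mk (vanishing C) with hmk
  have hJmap : J.map mk = Ideal.span {mk ℓ} := by
    rw [hJdef, Ideal.map_sup, Ideal.map_quotient_self, bot_sup_eq, Ideal.map_span, Set.image_singleton]
  have hker : RingHom.ker mk = vanishing C := Ideal.mk_ker
  have h𝔓 : 𝔮.map mk ∈ (Ideal.span {mk ℓ}).minimalPrimes := by
    rw [← hJmap, Ideal.minimalPrimes_map_of_surjective Ideal.Quotient.mk_surjective, hker,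
      sup_eq_left.mpr (le_sup_left : vanishing C ≤ J)]
    exact ⟨𝔮, h𝔮J, rfl⟩
  haveI h𝔓prime : (𝔮.map mk).IsPrime := h𝔓.isPrime
  -- height one
  have hℓ0 : mk ℓ ≠ 0 := by
    intro h; exact hℓ (Ideal.Quotient.eq_zero_iff_mem.mp h)
  have hne : 𝔮.map mk ≠ ⊥ := by
    intro h
    have : mk ℓ ∈ 𝔮.map mk := h𝔓.le (Ideal.subset_span rfl)
    rw [h, Submodule.mem_bot] at this
    exact hℓ0 this
  have hheight : (𝔮.map mk).height = 1 := by
    refine le_antisymm (Ideal.height_le_one_of_isPrincipal_of_mem_minimalPrimes _ _ h𝔓) ?_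
    rw [Order.one_le_iff_ne_zero, Ne, Ideal.height_eq_zero_iff_eq_bot]
    exact hne
  have hdim := Literature.RingTheory.KrullDimension.ringKrullDim_quotient_add_one_of_height_eq_one ℂ
    (𝔮.map mk) hheight
  -- identify the rings
  have hC𝔮 : vanishing C ≤ 𝔮 := le_sup_left.trans hJ𝔮
  have e1 := ringKrullDim_eq_of_ringEquiv (DoubleQuot.quotQuotEquivQuotOfLE hC𝔮)
  rw [e1] at hdim
  have hv𝔮 : vanishing (zeroSet (n := n) ↑𝔮) = 𝔮 := vanishing_zeroSet_eq_of_isPrime h𝔮.isPrime hu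
  have hne𝔮 : (zeroSet (n := n) ↑𝔮).Nonempty := (isIrred_zeroSet_of_mem_minimalPrimes h𝔮).1.nonempty
  have hd1 := dimG_eq hne𝔮
  rw [hv𝔮] at hd1
  rw [← hd1, ← dimG_eq hC.nonempty] at hdim
  have : (dimG (zeroSet (n := n) ↑𝔮) : WithBot ℕ∞) + 1 = ((dimG (zeroSet (n := n) ↑𝔮) + 1 : ℕ) : WithBot ℕ∞) := by
    push_cast; rfl
  rw [this] at hdim
  exact_mod_cast hdim

/-! ### Translations -/

/-- The pull-back of affine polynomials under the translation `g ↦ a·g` of `G(ℂ)`: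
`X ↦ X + a₀`, `Y_h ↦ a_h Y_h`. [folklore] -/
def shift (a : GaGm n) : MvPolynomial (Fin (n + 1)) ℂ →ₐ[ℂ] MvPolynomial (Fin (n + 1)) ℂ :=
  aeval (Fin.cons (X 0 + C (Multiplicative.toAdd a.1)) (fun h => C ((a.2 h : ℂˣ) : ℂ) * X h.succ))

/-- `shift a (X) = X + a₀`. [folklore] -/
theorem shift_X_zero (a : GaGm n) : shift a (X 0) = X 0 + C (Multiplicative.toAdd a.1) := by
  simp [shift]

/-- `shift a (Y_h) = a_h Y_h`. [folklore] -/
theorem shift_X_succ (a : GaGm n) (h : Fin n) : shift a (X h.succ) = C ((a.2 h : ℂˣ) : ℂ) * X h.succ := by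
  simp [shift]

/-- `(shift a P)(g) = P(a·g)`. [folklore] -/
theorem evalAt_shift (a : GaGm n) (P : MvPolynomial (Fin (n + 1)) ℂ) (g : GaGm n) :
    evalAt (shift a P) g = evalAt P (a * g) := by
  simp only [evalAt_eq_eval]
  induction P using MvPolynomial.induction_on with
  | C c => simp [shift]
  | add p q hp hq => rw [map_add, map_add, map_add, hp, hq]
  | mul_X p i hp =>
    rw [map_mul, map_mul, map_mul, hp]
    congr 1
    refine Fin.cases ?_ (fun h => ?_) i
    · simp [shift_X_zero, toAdd_mul, add_comm]
    · simp [shift_X_succ]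

/-- `shift e = id`. [folklore] -/
theorem shift_one : shift (1 : GaGm n) = AlgHom.id ℂ _ := by
  refine MvPolynomial.algHom_ext fun i => ?_
  refine Fin.cases ?_ (fun h => ?_) i
  · simp [shift_X_zero]
  · simp [shift_X_succ]

/-- `shift (ab) = shift b ∘ shift a`. [folklore] -/
theorem shift_mul (a b : GaGm n) : shift (a * b) = (shift b).comp (shift a) := by
  refine MvPolynomial.algHom_ext fun i => ?_
  refine Fin.cases ?_ (fun h => ?_) i
  · simp only [AlgHom.comp_apply, shift_X_zero, map_add, MvPolynomial.algHom_C, Prod.fst_mul,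
      toAdd_mul, MvPolynomial.algebraMap_eq]
    ring
  · simp only [AlgHom.comp_apply, shift_X_succ, map_mul, MvPolynomial.algHom_C, Prod.snd_mul,
      Pi.mul_apply, Units.val_mul, MvPolynomial.algebraMap_eq]
    ring

/-- Translations act by algebra automorphisms. [folklore] -/
def shiftEquiv (a : GaGm n) : MvPolynomial (Fin (n + 1)) ℂ ≃ₐ[ℂ] MvPolynomial (Fin (n + 1)) ℂ :=
  AlgEquiv.ofAlgHom (shift a) (shift a⁻¹)
    (by rw [← shift_mul, inv_mul_cancel, shift_one])
    (by rw [← shift_mul, mul_inv_cancel, shift_one])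

/-- Unfolding `shiftEquiv`. [folklore] -/
@[simp] theorem shiftEquiv_apply (a : GaGm n) (P : MvPolynomial (Fin (n + 1)) ℂ) :
    shiftEquiv a P = shift a P := rfl

/-- Translations preserve the box degrees. [folklore] -/
theorem shift_mem_Box {D₀ D₁ t : ℕ} (a : GaGm n) {P : MvPolynomial (Fin (n + 1)) ℂ}
    (hP : P ∈ Box D₀ D₁ t) : shift a P ∈ Box D₀ D₁ t := by
  classical
  -- degree bounds of the substituted variables
  set f : Fin (n + 1) → MvPolynomial (Fin (n + 1)) ℂ :=
    Fin.cons (X 0 + C (Multiplicative.toAdd a.1)) (fun h => C ((a.2 h : ℂˣ) : ℂ) * X h.succ) with hf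
  have hfdeg : ∀ i j : Fin (n + 1), (f j).degreeOf i ≤ if i = j then 1 else 0 := by
    intro i j
    refine Fin.cases ?_ (fun h => ?_) j
    · simp only [f, Fin.cons_zero]
      refine (degreeOf_add_le _ _ _).trans ?_
      rw [degreeOf_C, degreeOf_X]
      split_ifs <;> simp
    · simp only [f, Fin.cons_succ]
      refine (degreeOf_C_mul_le _ _ _).trans ?_
      rw [degreeOf_X]
  -- degree of the image of a monomial
  have hmon : ∀ (s : Fin (n + 1) →₀ ℕ) (c : ℂ) (i : Fin (n + 1)),
      (shift a (monomial s c)).degreeOf i ≤ s i := by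
    intro s c i
    rw [shift, aeval_monomial, ← hf]
    refine (degreeOf_C_mul_le _ _ _).trans ?_
    rw [Finsupp.prod]
    refine (degreeOf_prod_le _ _ _).trans ?_
    calc ∑ j ∈ s.support, (f j ^ s j).degreeOf i
        ≤ ∑ j ∈ s.support, s j * (if i = j then 1 else 0) :=
          Finset.sum_le_sum fun j _ => (degreeOf_pow_le _ _ _).trans (Nat.mul_le_mul_left _ (hfdeg i j))
      _ ≤ s i := by
          simp only [mul_ite, mul_one, mul_zero, Finset.sum_ite_eq]
          split_ifs <;> simp
  -- sum over the support
  have hsupp : (P.support : Set (Fin (n + 1) →₀ ℕ)) ⊆ boxSet D₀ D₁ t := (mem_restrictSupport_iff ℂ).mp hP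
  rw [mem_Box_iff]
  have key : ∀ i : Fin (n + 1), (shift a P).degreeOf i ≤ P.support.sup (fun s => s i) := by
    intro i
    conv_lhs => rw [P.as_sum, map_sum]
    refine (degreeOf_sum_le _ _ _).trans (Finset.sup_mono_fun fun s _ => hmon s _ i)
  refine ⟨(key 0).trans (Finset.sup_le fun s hs => (hsupp hs).1), fun h => ?_⟩
  exact (key h.succ).trans (Finset.sup_le fun s hs => (hsupp hs).2 h)

open Pointwise in
/-- `𝔍(a·X) = shift(a)⁻¹(𝔍 X)`: `P` vanishes on `a·X` iff `P(a·)` vanishes on `X`. [folklore] -/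
theorem vanishing_smul (a : GaGm n) (X : Set (GaGm n)) :
    vanishing (a • X) = (vanishing X).comap (shift a) := by
  ext P
  simp only [Ideal.mem_comap, mem_vanishing_iff, Set.mem_smul_set, smul_eq_mul,
    forall_exists_index, and_imp]
  constructor
  · intro h g hg
    rw [evalAt_shift]
    exact h (a * g) g hg rfl
  · rintro h _ g hg rfl
    have := h g hg
    rwa [evalAt_shift] at this

open Pointwise in
/-- The zero set of translated polynomials is the translated zero set. [folklore] -/
theorem zeroSet_image_shift (a : GaGm n) (F : Set (MvPolynomial (Fin (n + 1)) ℂ)) :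
    zeroSet (shift a '' F) = a⁻¹ • zeroSet (n := n) F := by
  ext g
  rw [Set.mem_inv_smul_set_iff, smul_eq_mul]
  simp only [mem_zeroSet_iff, Set.forall_mem_image, evalAt_shift]

open Pointwise in
/-- Translates of closed sets are closed. [folklore] -/
theorem IsClosedG.smul {X : Set (GaGm n)} (hX : IsClosedG X) (a : GaGm n) : IsClosedG (a • X) := by
  have h : a • X = zeroSet (shift a⁻¹ '' (vanishing X : Set (MvPolynomial (Fin (n + 1)) ℂ))) := by
    rw [zeroSet_image_shift, inv_inv, hX.eq]
  rw [h]; exact isClosedG_zeroSet _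

open Pointwise in
/-- Translates of irreducible closed sets are irreducible closed. [folklore] -/
theorem IsIrred.smul {X : Set (GaGm n)} (hX : IsIrred X) (a : GaGm n) : IsIrred (a • X) := by
  refine ⟨hX.isClosedG.smul a, ?_⟩
  rw [vanishing_smul]
  haveI := hX.isPrime
  exact Ideal.comap_isPrime _ _

open Pointwise in
/-- Dimension is invariant under translation. [folklore] -/
theorem dimG_smul (a : GaGm n) (X : Set (GaGm n)) : dimG (a • X) = dimG X := by
  by_cases hX : X.Nonempty
  · have hne : (a • X).Nonempty := hX.smul_set
    have h1 := dimG_eq hne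
    rw [vanishing_smul] at h1
    set f : MvPolynomial (Fin (n + 1)) ℂ ≃+* MvPolynomial (Fin (n + 1)) ℂ := (shiftEquiv a).toRingEquiv
      with hf
    have e : (vanishing X).comap (shift a) = (vanishing X).comap f := by
      ext P
      simp only [Ideal.mem_comap]
      rfl
    have e2 : vanishing X = ((vanishing X).comap f).map f :=
      (Ideal.map_comap_of_surjective f f.surjective _).symm
    rw [e, ringKrullDim_eq_of_ringEquiv (Ideal.quotientEquiv _ _ f e2), ← dimG_eq hX] at h1
    exact_mod_cast h1
  · rw [Set.not_nonempty_iff_eq_empty] at hX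
    rw [hX, Set.smul_set_empty]

/-! ### The dimension of a closed set is attained on a component -/

/-- `𝔍(Z(𝔍(X))) = 𝔍(X)`. [folklore] -/
theorem vanishing_zeroSet_vanishing (X : Set (GaGm n)) :
    vanishing (zeroSet (n := n) (vanishing X : Set (MvPolynomial (Fin (n + 1)) ℂ))) = vanishing X :=
  le_antisymm (vanishing_antitone (subset_zeroSet_vanishing X)) (subset_vanishing_zeroSet _)

/-- `dim Z(𝔍(X)) = dim X`. [folklore] -/
theorem dimG_zeroSet_vanishing (X : Set (GaGm n)) :
    dimG (zeroSet (n := n) (vanishing X : Set (MvPolynomial (Fin (n + 1)) ℂ))) = dimG X := by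
  rw [dimG, vanishing_zeroSet_vanishing, dimG]

/-- **Some component has full dimension**: for non-empty `X` there is a minimal prime `𝔮` of
`𝔍(X)` with `dim Z(𝔮) = dim X` (a maximal chain of primes above `𝔍(X)` starts at a minimal
prime). [folklore] -/
theorem exists_minimalPrimes_dimG_eq {X : Set (GaGm n)} (hX : X.Nonempty) :
    ∃ 𝔮 ∈ (vanishing X).minimalPrimes, dimG (zeroSet (n := n) ↑𝔮) = dimG X := by
  classical
  set I := vanishing X with hI
  set d := dimG X with hd
  have hdim : (d : WithBot ℕ∞) = ringKrullDim (MvPolynomial (Fin (n + 1)) ℂ ⧸ I) := dimG_eq hX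
  -- a chain of primes of length `d` in `B ⧸ I`
  obtain ⟨l, hl⟩ : ∃ l : LTSeries (PrimeSpectrum (MvPolynomial (Fin (n + 1)) ℂ ⧸ I)), l.length = d := by
    rw [← Order.le_krullDim_iff]
    change ((d : ℕ∞) : WithBot ℕ∞) ≤ ringKrullDim (MvPolynomial (Fin (n + 1)) ℂ ⧸ I)
    rw [← hdim]
    rfl
  set mkI := Ideal.Quotient.mk I with hmkI
  -- the bottom of the chain contains a minimal prime `𝔮`
  have h0 : I ≤ (l 0).asIdeal.comap mkI := by
    have h := Ideal.ker_le_comap (K := (l 0).asIdeal) mkI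
    rwa [hmkI, Ideal.mk_ker] at h
  haveI : ((l 0).asIdeal.comap mkI).IsPrime := Ideal.comap_isPrime _ _
  obtain ⟨𝔮, h𝔮, h𝔮0⟩ := Ideal.exists_minimalPrimes_le h0
  haveI := h𝔮.isPrime
  refine ⟨𝔮, h𝔮, le_antisymm ?_ ?_⟩
  · rw [hd, ← dimG_zeroSet_vanishing X]
    exact dimG_mono (zeroSet_antitone h𝔮.le)
  · -- transport the chain to `B ⧸ 𝔮`
    set mk𝔮 := Ideal.Quotient.mk 𝔮 with hmk𝔮
    have hle : ∀ i, 𝔮 ≤ (l i).asIdeal.comap mkI := fun i =>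
      h𝔮0.trans (Ideal.comap_mono ((PrimeSpectrum.asIdeal_le_asIdeal _ _).mpr
        (l.strictMono.monotone (Fin.zero_le i))))
    have hprime : ∀ i, (((l i).asIdeal.comap mkI).map mk𝔮).IsPrime := fun i => by
      haveI : ((l i).asIdeal.comap mkI).IsPrime := Ideal.comap_isPrime _ _
      exact Ideal.map_isPrime_of_surjective Ideal.Quotient.mk_surjective (by rw [Ideal.mk_ker]; exact hle i)
    let l' : LTSeries (PrimeSpectrum (MvPolynomial (Fin (n + 1)) ℂ ⧸ 𝔮)) :=
      { length := l.length
        toFun := fun i => ⟨((l i).asIdeal.comap mkI).map mk𝔮, hprime i⟩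
        step := fun i => by
          have hlt : l i.castSucc < l i.succ := l.step i
          rw [← PrimeSpectrum.asIdeal_lt_asIdeal] at hlt
          change (⟨((l i.castSucc).asIdeal.comap mkI).map mk𝔮, hprime _⟩ : PrimeSpectrum _) <
            ⟨((l i.succ).asIdeal.comap mkI).map mk𝔮, hprime _⟩
          rw [← PrimeSpectrum.asIdeal_lt_asIdeal]
          change ((l i.castSucc).asIdeal.comap mkI).map mk𝔮 < ((l i.succ).asIdeal.comap mkI).map mk𝔮
          have hlt' : (l i.castSucc).asIdeal.comap mkI < (l i.succ).asIdeal.comap mkI :=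
            lt_of_le_of_ne (Ideal.comap_mono hlt.le) fun h =>
              hlt.ne (Ideal.comap_injective_of_surjective _ Ideal.Quotient.mk_surjective h)
          refine lt_of_le_of_ne (Ideal.map_mono hlt'.le) fun h => hlt'.ne ?_
          have h1 := congrArg (Ideal.comap mk𝔮) h
          rwa [Ideal.comap_map_of_surjective _ Ideal.Quotient.mk_surjective,
            Ideal.comap_map_of_surjective _ Ideal.Quotient.mk_surjective,
            ← RingHom.ker_eq_comap_bot, Ideal.mk_ker, sup_eq_left.mpr (hle _),
            sup_eq_left.mpr (hle _)] at h1 }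
    have hlen : (l'.length : WithBot ℕ∞) ≤ ringKrullDim (MvPolynomial (Fin (n + 1)) ℂ ⧸ 𝔮) :=
      Order.LTSeries.length_le_krullDim l'
    have hv : vanishing (zeroSet (n := n) ↑𝔮) = 𝔮 := (isIrred_zeroSet_of_mem_minimalPrimes h𝔮).2.1
    have hne : (zeroSet (n := n) ↑𝔮).Nonempty := (isIrred_zeroSet_of_mem_minimalPrimes h𝔮).1.nonempty
    have hd𝔮 := dimG_eq hne
    rw [hv] at hd𝔮
    rw [← hd𝔮] at hlen
    have : l'.length = d := hl
    rw [this] at hlen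
    exact_mod_cast hlen

/-- An irreducible closed set has no proper closed non-empty subset of the same dimension.
[folklore] -/
theorem IsIrred.eq_of_subset_of_dimG_eq {V C : Set (GaGm n)} (hC : IsIrred C) (hV : IsClosedG V)
    (hVne : V.Nonempty) (h : V ⊆ C) (hd : dimG V = dimG C) : V = C := by
  by_contra hne
  have hlt := dimG_lt_of_ssubset hC hV hVne (Set.ssubset_iff_subset_ne.mpr ⟨h, hne⟩)
  omega

/-- An irreducible closed subset of a closed set `X` of dimension `dim X` is a component of `X`.
[folklore] -/
theorem IsIrred.exists_eq_zeroSet_minimalPrimes {V X : Set (GaGm n)} (hV : IsIrred V) (hX : IsClosedG X)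
    (hVX : V ⊆ X) (hd : dimG V = dimG X) :
    ∃ 𝔮 ∈ (vanishing X).minimalPrimes, V = zeroSet (n := n) ↑𝔮 := by
  obtain ⟨𝔮, h𝔮, hV𝔮⟩ := hV.exists_minimalPrimes_subset hVX
  obtain ⟨hirr, -, hsub⟩ := isIrred_zeroSet_of_mem_minimalPrimes h𝔮
  rw [hX.eq] at hsub
  refine ⟨𝔮, h𝔮, hirr.eq_of_subset_of_dimG_eq hV.isClosedG hV.nonempty hV𝔮 (le_antisymm ?_ ?_)⟩
  · exact dimG_mono hV𝔮
  · rw [hd]; exact dimG_mono hsub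

end GaGm

end Literature.NumberTheory.Transcendental
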